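/-
Copyright (c) 2026. All rights reserved.
Released under Apache 2.0 license as described in the file LICENSE.
Authors: abc-iut cell, seat abc-iut-w6-d025 (gen 2; block C / W6, row «Cor36-SHIFT-TELE»).
-/
import Literature.AnabelianGeometry.AbsoluteAnabelian.AbsTopIII.FrobeniusPictureMLFTelecoreShift

/-!
# [AbsTopIII] Corollary 3.6 (v), fourth sentence: the universal family of `𝒟_An` is INVARIANT under
# the extended shifts `Ψ_m`

S. Mochizuki, *Topics in Absolute Anabelian Geometry III*, Cor. 3.6 (v) p. 80 of the kurims
manuscript (`paper:url-5493eb38cbb7`; bib key `MochizukiAbsTopIII2015`), fourth sentence ("these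
self-equivalences also extend naturally … to the diagram of categories … that constitutes the
telecore of (ii), in a fashion that is compatible with both the family of homotopies that
constitutes this telecore structure … and the contact structure `ℋ_An` of (ii)"; proof p. 82:
"follows immediately from the definitions").

Proof-only continuation of `FrobeniusPictureMLFTelecoreShift.lean` (the extended shifts
`teleShiftEquiv m` of the telecore diagram `𝒟_An = Δ.teleDiagram anJ (Δ.anTelMap τ)`), following
seat abc-iut-L4-t3's Cor. 5.5 (v) twin (`LogFrobeniusTelecoreShiftCompat.lean`) step by step.  The
telecore family `𝒥` of `𝔗_An = anTelecore τ hν` and the contact structure `ℋ_An = anContact τ hν`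
(seat abc-iut-L4-t5, `FrobeniusPictureMLFTelecoreConstruction.lean`) are both restrictions of the
universal family `K = anUniv τ hν` of `𝒟_An`, whose homotopies are the lifts through the structure
functors to `𝒳` (`anOver τ`: `id_⋎` on the first row, `𝟭` at `□`, `φ_An ∘ κ_An` at `ℰ`, `φ_An` at
`Anab`), fully faithful at every vertex of `anW` (all but `𝒩`).  Here: these structure functors
are INVARIANT under the shifts (`teleShift_N_obj`, `teleShift_μ_app_heq` — all the data are indexed
uniformly in `⋎`), hence so are the isomorphisms `pathIso` (`teleShift_pathIso_app_heq`), the lifts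
(`teleShift_lift_app_heq`) and the homotopies of `K` (`teleShift_anUniv_η_heq`: the homotopy of `K`
on a shifted pair, at `Ψ_a x`, is `Ψ_b` applied to the homotopy on the pair at `x`).  The Def. 3.5
(v) compatibility statements and `ShiftTelecoreCompatStmt` itself are assembled in
`FrobeniusPictureMLFShiftTelecoreCompatible.lean`.  Pure category theory (`eqToHom` / `HEq`
bookkeeping); nothing here takes a side on inter-universal Teichmüller theory or bears on
[IUTchIII] Cor. 3.12.
-/

namespace Literature.AnabelianGeometry.AbsoluteAnabelian

open _root_.CategoryTheory _root_.Quiver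

universe u

namespace LogFrobeniusData

open DiagramOfCategories

variable (Δ : LogFrobeniusData.{u}) (τ : Δ.TelecoreData)

/-! ### Bookkeeping under `≍` -/

section HEqTools

variable {C : Type u} [Category.{u} C] {C' : Type u} [Category.{u} C']

/-- `eqToHom`s between pairwise equal objects are heterogeneously equal. [folklore] -/
private theorem heq_eqToHom_eqToHom {X Y X' Y' : C} (h : X = Y) (h' : X' = Y') (e : X = X') :
    HEq (eqToHom h) (eqToHom h') := by
  subst e; subst h; subst h'; rfl

/-- Components of a natural transformation at equal objects are heterogeneously equal. [folklore] -/
private theorem natTrans_app_heq {A : Type u} [Category.{u} A] {F G : A ⥤ C} (α : F ⟶ G) {y y' : A}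
    (hy : y = y') : HEq (α.app y) (α.app y') := by
  subst hy; rfl

/-- A functor maps heterogeneously equal morphisms to heterogeneously equal morphisms. [folklore] -/
private theorem functor_map_heq (G : C ⥤ C') {A B A' B' : C} (hA : A = A') (hB : B = B') {f : A ⟶ B}
    {f' : A' ⟶ B'} (h : HEq f f') : HEq (G.map f) (G.map f') := by
  subst hA hB; cases h; rfl

/-- The inverses of heterogeneously equal isomorphisms (between equal objects) are heterogeneously
equal. [folklore] -/
private theorem iso_inv_heq' {X Y X' Y' : C} (i : X ≅ Y) (i' : X' ≅ Y') (hX : X = X') (hY : Y = Y')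
    (h : HEq i.hom i'.hom) : HEq i.inv i'.inv := by
  subst hX hY
  obtain rfl : i = i' := Iso.ext (eq_of_heq h)
  rfl

/-- Cancelling a faithful functor under `≍`. [folklore] -/
private theorem heq_of_map_heq (G : C ⥤ C') (hG : G.FullyFaithful) {A B A' B' : C} (hA : A = A')
    (hB : B = B') {f : A ⟶ B} {f' : A' ⟶ B'} (h : HEq (G.map f) (G.map f')) : HEq f f' := by
  subst hA hB
  exact heq_of_eq (hG.map_injective (eq_of_heq h))

end HEqTools

/-! ### The structure functors of `𝒟_An` over `𝒳` are invariant under the shifts -/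

/-- The structure functors are invariant under the shift, on objects: `N_{w+m}(Ψ_w y) = N_w(y)`.
[cite: MochizukiAbsTopIII2015, Corollary 3.6 (v) p.80] -/
theorem teleShift_N_obj (m : ℤ) (w : (teleShape anJ.{u}).Vertex)
    (y : (Δ.teleDiagram anJ (Δ.anTelMap τ)).obj w) :
    ((Δ.anOver τ).N (teleShiftObj m w)).obj ((Δ.teleShiftApp τ m w).obj y) =
      ((Δ.anOver τ).N w).obj y := by
  cases w with
  | obs => rfl
  | base a =>
    obtain ⟨x, hx⟩ := a
    cases x <;> rfl

/-- The structure functors are invariant under the shift, on morphisms (heterogeneously).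
[cite: MochizukiAbsTopIII2015, Corollary 3.6 (v) p.80] -/
theorem teleShift_N_map_heq (m : ℤ) (w : (teleShape anJ.{u}).Vertex)
    {y y' : (Δ.teleDiagram anJ (Δ.anTelMap τ)).obj w} (f : y ⟶ y') :
    HEq (((Δ.anOver τ).N (teleShiftObj m w)).map ((Δ.teleShiftApp τ m w).map f))
      (((Δ.anOver τ).N w).map f) := by
  cases w with
  | obs => rfl
  | base a =>
    obtain ⟨x, hx⟩ := a
    cases x <;> rfl

/-- The vertex functors of the shift act trivially on morphisms (heterogeneously): `Ψ_w(f) ≍ f`.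
[cite: MochizukiAbsTopIII2015, Corollary 3.6 (v) p.80] -/
theorem teleShiftApp_map_heq (m : ℤ) (w : (teleShape anJ.{u}).Vertex)
    {y y' : (Δ.teleDiagram anJ (Δ.anTelMap τ)).obj w} (f : y ⟶ y') :
    HEq ((Δ.teleShiftApp τ m w).map f) f := by
  cases w with
  | obs => rfl
  | base a =>
    obtain ⟨x, hx⟩ := a
    cases x <;> rfl

/-- **The structure isomorphisms `μ` of `𝒟_An` are invariant under the shift**, componentwise
(heterogeneously): every `μ` (`log ≅ 𝟭` whiskered, unitors, `η_An ∘ eqToIso` on `λ^×`, `λ^{×pf}`, `e`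
on `φ_⋎`, identities) is indexed uniformly in `⋎`. [cite: MochizukiAbsTopIII2015, Corollary 3.6 (v) p.80] -/
theorem teleShift_μ_app_heq (m : ℤ) {b c : (teleShape anJ.{u}).Vertex} (e : b ⟶ c)
    (y : (Δ.teleDiagram anJ (Δ.anTelMap τ)).obj b) :
    HEq (((Δ.anOver τ).μ (teleShiftHom m e)).hom.app ((Δ.teleShiftApp τ m b).obj y))
      (((Δ.anOver τ).μ e).hom.app y) := by
  cases b with
  | obs =>
    cases c with
    | obs => exact PEmpty.elim e
    | base c =>
      obtain ⟨x, hx⟩ := c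
      cases x <;> first | exact (PEmpty.elim e) | exact HEq.rfl
  | base b =>
    obtain ⟨x, hx⟩ := b
    cases c with
    | obs => cases x <;> first | exact (PEmpty.elim e) | exact HEq.rfl
    | base c =>
      obtain ⟨x', hx'⟩ := c
      cases x <;> cases x' <;>
        first
          | exact (PEmpty.elim e)
          | exact (not_fifth_le_four hx).elim
          | exact HEq.rfl

/-! ### The shift commutes with the path functors; `pathIso` and the lifts are invariant -/

/-- The shift commutes (strictly) with the path functors of `𝒟_An`: `Ψ_a ⋙ 𝒟_[Ψγ] = 𝒟_[γ] ⋙ Ψ_b`.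
[cite: MochizukiAbsTopIII2015, Corollary 3.6 (v) p.80] -/
theorem teleShift_pathComm (m : ℤ) {a b : (teleShape anJ.{u}).Vertex} (p : Path a b) :
    Δ.teleShiftApp τ m a ⋙ (Δ.teleDiagram anJ (Δ.anTelMap τ)).pathFunctor ((teleShift m).mapPath p) =
      (Δ.teleDiagram anJ (Δ.anTelMap τ)).pathFunctor p ⋙ Δ.teleShiftApp τ m b := by
  induction p with
  | nil =>
    erw [Prefunctor.mapPath_nil, pathFunctor_nil, pathFunctor_nil]
    rfl
  | cons p e ih =>
    erw [Prefunctor.mapPath_cons, pathFunctor_cons, pathFunctor_cons, ← Functor.assoc, ih,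
      Functor.assoc, Δ.teleShift_comm' τ m e, ← Functor.assoc]

/-- Objects along shifted paths: `𝒟_[Ψγ](Ψ_a x) = Ψ_b(𝒟_[γ] x)`. [cite: MochizukiAbsTopIII2015, Corollary 3.6 (v) p.80] -/
theorem teleShift_pathFunctor_obj (m : ℤ) {a b : (teleShape anJ.{u}).Vertex} (p : Path a b)
    (x : (Δ.teleDiagram anJ (Δ.anTelMap τ)).obj a) :
    ((Δ.teleDiagram anJ (Δ.anTelMap τ)).pathFunctor ((teleShift m).mapPath p)).obj
        ((Δ.teleShiftApp τ m a).obj x) =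
      (Δ.teleShiftApp τ m b).obj (((Δ.teleDiagram anJ (Δ.anTelMap τ)).pathFunctor p).obj x) :=
  Functor.congr_obj (Δ.teleShift_pathComm τ m p) x

/-- **`pathIso` is invariant under the shift**, componentwise (heterogeneously): `pathIso (Ψγ)` at
`Ψ_a x` is `pathIso γ` at `x`. [cite: MochizukiAbsTopIII2015, Corollary 3.6 (v) p.80] -/
theorem teleShift_pathIso_app_heq (m : ℤ) {a b : (teleShape anJ.{u}).Vertex} (p : Path a b)
    (x : (Δ.teleDiagram anJ (Δ.anTelMap τ)).obj a) :
    HEq (((Δ.anOver τ).pathIso ((teleShift m).mapPath p)).hom.app ((Δ.teleShiftApp τ m a).obj x))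
      (((Δ.anOver τ).pathIso p).hom.app x) := by
  induction p with
  | nil =>
    rw [Prefunctor.mapPath_nil]
    erw [OverData.pathIso_nil_app, OverData.pathIso_nil_app]
    refine heq_eqToHom_eqToHom _ _ ?_
    show ((Δ.anOver τ).N (teleShiftObj m a)).obj
        (((Δ.teleDiagram anJ (Δ.anTelMap τ)).pathFunctor Path.nil).obj ((Δ.teleShiftApp τ m a).obj x)) =
      ((Δ.anOver τ).N a).obj (((Δ.teleDiagram anJ (Δ.anTelMap τ)).pathFunctor Path.nil).obj x)
    erw [pathFunctor_nil, pathFunctor_nil]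
    exact Δ.teleShift_N_obj τ m a x
  | cons p e ih =>
    rename_i b c
    have hy := Δ.teleShift_pathFunctor_obj τ m p x
    have he := Functor.congr_obj (Δ.teleShift_comm' τ m e)
      (((Δ.teleDiagram anJ (Δ.anTelMap τ)).pathFunctor p).obj x)
    have o₄ : ((Δ.anOver τ).N (teleShiftObj m a)).obj ((Δ.teleShiftApp τ m a).obj x) =
        ((Δ.anOver τ).N a).obj x :=
      Δ.teleShift_N_obj τ m a x
    have o₃ : ((Δ.anOver τ).N (teleShiftObj m b)).obj
        (((Δ.teleDiagram anJ (Δ.anTelMap τ)).pathFunctor ((teleShift m).mapPath p)).obj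
          ((Δ.teleShiftApp τ m a).obj x)) =
        ((Δ.anOver τ).N b).obj (((Δ.teleDiagram anJ (Δ.anTelMap τ)).pathFunctor p).obj x) := by
      rw [hy]; exact Δ.teleShift_N_obj τ m b _
    have o₂ : ((Δ.anOver τ).N (teleShiftObj m c)).obj
        (((Δ.teleDiagram anJ (Δ.anTelMap τ)).map ((teleShift m).map e)).obj
          (((Δ.teleDiagram anJ (Δ.anTelMap τ)).pathFunctor ((teleShift m).mapPath p)).obj
            ((Δ.teleShiftApp τ m a).obj x))) =
        ((Δ.anOver τ).N c).obj (((Δ.teleDiagram anJ (Δ.anTelMap τ)).map e).obj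
          (((Δ.teleDiagram anJ (Δ.anTelMap τ)).pathFunctor p).obj x)) := by
      rw [hy]
      erw [he]
      exact Δ.teleShift_N_obj τ m c _
    have o₁ : ((Δ.anOver τ).N (teleShiftObj m c)).obj
        (((Δ.teleDiagram anJ (Δ.anTelMap τ)).pathFunctor
          (((teleShift m).mapPath p).cons ((teleShift m).map e))).obj ((Δ.teleShiftApp τ m a).obj x)) =
        ((Δ.anOver τ).N c).obj (((Δ.teleDiagram anJ (Δ.anTelMap τ)).pathFunctor (p.cons e)).obj x) := by
      erw [pathFunctor_cons, pathFunctor_cons]; exact o₂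
    rw [Prefunctor.mapPath_cons]
    erw [OverData.pathIso_cons_app, OverData.pathIso_cons_app]
    refine heq_comp o₁ o₂ o₄ (heq_eqToHom_eqToHom _ _ o₁) (heq_comp o₂ o₃ o₄ ?_ ih)
    exact (natTrans_app_heq _ hy).trans (Δ.teleShift_μ_app_heq τ m e _)

section Lifts

variable (hν : Δ.toNexus.FullyFaithful)

/-- The fully faithful vertex set `anW` (every vertex but `𝒩`) is stable under the shifts.
[cite: MochizukiAbsTopIII2015, Corollary 3.6 (v) p.80] -/
theorem anW_teleShift (m : ℤ) {w : (teleShape anJ.{u}).Vertex} (hw : anW w) :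
    anW (teleShiftObj m w) := by
  cases w with
  | obs => trivial
  | base a =>
    obtain ⟨x, hx⟩ := a
    cases x <;> trivial

/-- **The lifts are invariant under the shift** (through the fully faithful vertices and their
shifts): the lift of `(Ψγ₁, Ψγ₂)` at `Ψ_a x` is `Ψ_w` applied to the lift of `(γ₁, γ₂)` at `x`, up to
the object identities of `teleShift_pathFunctor_obj`. [cite: MochizukiAbsTopIII2015, Corollary 3.6 (v) p.80] -/
theorem teleShift_lift_app_heq (m : ℤ) {a w : (teleShape anJ.{u}).Vertex} (hw : anW w)
    (hw' : anW (teleShiftObj m w)) (p q : Path a w) (x : (Δ.teleDiagram anJ (Δ.anTelMap τ)).obj a) :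
    HEq (((Δ.anOver τ).lift (Δ.anFF τ hν _ hw') ((teleShift m).mapPath p) ((teleShift m).mapPath q)).app
        ((Δ.teleShiftApp τ m a).obj x))
      ((Δ.teleShiftApp τ m w).map (((Δ.anOver τ).lift (Δ.anFF τ hν w hw) p q).app x)) := by
  refine heq_of_map_heq ((Δ.anOver τ).N (teleShiftObj m w)) (Δ.anFF τ hν _ hw')
    (Δ.teleShift_pathFunctor_obj τ m p x) (Δ.teleShift_pathFunctor_obj τ m q x) ?_
  erw [OverData.map_lift_app]
  refine HEq.trans ?_ (Δ.teleShift_N_map_heq τ m w _).symm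
  erw [OverData.map_lift_app]
  have o₁ := Δ.teleShift_pathFunctor_obj τ m p x
  have o₂ := Δ.teleShift_pathFunctor_obj τ m q x
  refine heq_comp ?_ (Δ.teleShift_N_obj τ m a x) ?_ (Δ.teleShift_pathIso_app_heq τ m p x)
    (iso_inv_heq' (((Δ.anOver τ).pathIso ((teleShift m).mapPath q)).app ((Δ.teleShiftApp τ m a).obj x))
      (((Δ.anOver τ).pathIso q).app x) ?_ (Δ.teleShift_N_obj τ m a x)
      (Δ.teleShift_pathIso_app_heq τ m q x))
  · exact (congrArg ((Δ.anOver τ).N (teleShiftObj m w)).obj o₁).trans (Δ.teleShift_N_obj τ m w _)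
  · exact (congrArg ((Δ.anOver τ).N (teleShiftObj m w)).obj o₂).trans (Δ.teleShift_N_obj τ m w _)
  · exact (congrArg ((Δ.anOver τ).N (teleShiftObj m w)).obj o₂).trans (Δ.teleShift_N_obj τ m w _)

/-! ### The universal family `K = anUniv τ hν` of `𝒟_An` is invariant under the shifts -/

/-- The homotopies of the universal family `K` are computed by any decomposition through `anW`
(restatement of `univFamily_η_eq` for `anUniv`). [cite: MochizukiAbsTopIII2015, Definition 3.5 (ii) p.75] -/
theorem anUniv_η_eq_decomp {a b : (teleShape anJ.{u}).Vertex} {p q : Path a b}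
    (h : (Δ.anUniv τ hν).E p q) (d : Decomp anW p q) :
    (Δ.anUniv τ hν).η h = d.η (Δ.anOver τ) anW (Δ.anFF τ hν) :=
  univFamily_η_eq (Δ.anOver τ) anW (Δ.anFF τ hν) h d

/-- A pair in the boundary set of `K` stays there after the shift (the decompositions through `anW`
shift). [cite: MochizukiAbsTopIII2015, Corollary 3.6 (v) p.80] -/
theorem anUniv_E_teleShift (m : ℤ) {a b : (teleShape anJ.{u}).Vertex} {p q : Path a b}
    (h : (Δ.anUniv τ hν).E p q) :
    (Δ.anUniv τ hν).E ((teleShift m).mapPath p) ((teleShift m).mapPath q) := by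
  obtain ⟨d⟩ := h
  refine ⟨⟨(teleShift m).obj d.w, anW_teleShift m d.mem, (teleShift m).mapPath d.p,
    (teleShift m).mapPath d.q, (teleShift m).mapPath d.s, ?_, ?_⟩⟩
  · exact (congrArg (teleShift.{u} m).mapPath d.left_eq).trans (Prefunctor.mapPath_comp _ _ _)
  · exact (congrArg (teleShift.{u} m).mapPath d.right_eq).trans (Prefunctor.mapPath_comp _ _ _)

/-- **The universal family is invariant under the shifts**: the homotopy of `K` on a shifted pair, at
`Ψ_a x`, is `Ψ_b` applied to the homotopy on the pair at `x` (heterogeneously — the whiskered lifts of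
`Decomp.η` commute with the identity functors of the shift).
[cite: MochizukiAbsTopIII2015, Corollary 3.6 (v) p.80] -/
theorem teleShift_anUniv_η_heq (m : ℤ) {a b : (teleShape anJ.{u}).Vertex} {p q : Path a b}
    (h : (Δ.anUniv τ hν).E p q)
    (h' : (Δ.anUniv τ hν).E ((teleShift m).mapPath p) ((teleShift m).mapPath q))
    (x : (Δ.teleDiagram anJ (Δ.anTelMap τ)).obj a) :
    HEq (((Δ.anUniv τ hν).η h').app ((Δ.teleShiftApp τ m a).obj x))
      ((Δ.teleShiftApp τ m b).map (((Δ.anUniv τ hν).η h).app x)) := by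
  let d : Decomp anW p q := Classical.choice h
  -- the shifted decomposition
  have hl : (teleShift m).mapPath p = ((teleShift m).mapPath d.p).comp ((teleShift m).mapPath d.s) :=
    (congrArg (teleShift.{u} m).mapPath d.left_eq).trans (Prefunctor.mapPath_comp _ _ _)
  have hr : (teleShift m).mapPath q = ((teleShift m).mapPath d.q).comp ((teleShift m).mapPath d.s) :=
    (congrArg (teleShift.{u} m).mapPath d.right_eq).trans (Prefunctor.mapPath_comp _ _ _)
  let d' : Decomp anW ((teleShift m).mapPath p) ((teleShift m).mapPath q) :=
    ⟨(teleShift m).obj d.w, anW_teleShift m d.mem, (teleShift m).mapPath d.p,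
      (teleShift m).mapPath d.q, (teleShift m).mapPath d.s, hl, hr⟩
  rw [Δ.anUniv_η_eq_decomp τ hν h d, Δ.anUniv_η_eq_decomp τ hν h' d', Decomp.η, Decomp.η]
  erw [NatTrans.comp_app, NatTrans.comp_app, NatTrans.comp_app, NatTrans.comp_app, eqToHom_app,
    eqToHom_app, eqToHom_app, eqToHom_app, Functor.whiskerRight_app, Functor.whiskerRight_app,
    Functor.map_comp, Functor.map_comp, eqToHom_map, eqToHom_map]
  refine (eqToHom_comp_heq_iff _ _ _).2 ((heq_eqToHom_comp_iff _ _ _).2 ?_)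
  refine (comp_eqToHom_heq_iff _ _ _).2 ((heq_comp_eqToHom_iff _ _ _).2 ?_)
  -- the whiskered lifts
  have hL := Δ.teleShift_lift_app_heq τ hν m d.mem (anW_teleShift m d.mem) d.p d.q x
  refine (functor_map_heq ((Δ.teleDiagram anJ (Δ.anTelMap τ)).pathFunctor
      ((teleShift m).mapPath d.s)) (Δ.teleShift_pathFunctor_obj τ m d.p x)
      (Δ.teleShift_pathFunctor_obj τ m d.q x) hL).trans ?_
  exact Functor.hcongr_hom (Δ.teleShift_pathComm τ m d.s) _

end Lifts

end LogFrobeniusData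

end Literature.AnabelianGeometry.AbsoluteAnabelian
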